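import Summits.CriticalPhenomena.CardyFormulaZ2.Theorems.CardyBondTriangularBondTriangularCardyKiteBStep
import HarnessLib

/-!
# Route CardyBondTriangular · crux `BondTriangularCardy` · line `birth`: the blue arm of Claim 10 — the hexagons of `w`

Helper of the stub `stub_blueArm` (Bollobás–Riordan, *Percolation* (2006), Ch. 7, Claim 10
pp. 177–179, for the Chayes–Lei hexagon model). In the frame of `A₀`, with the separating yellow
path as the list `Q` of its hexagons (`Q = L₁ ++ x₁ :: x₂ :: L₂`, the bond `x₁x₂` of the face `w`
traversed with `w` on the left) and the standing hypothesis that no yellow path with the same end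
hexagons separates `w` from `A₀`: the **shortcut lemma** of `TriClaim10Prep.lean` in the
Chayes–Lei form (`faceLabel_loop_eq_zero_of_shortcutCL`), and Step 2 of the plan — **the three
hexagons of `w` are not all yellow at `w`** (`false_of_yellow_at_w`: otherwise reroute the path
through `x₃`, which is yellow-adjacent to `x₁` and `x₂` at the corner `w`; if `x₃` is off the path
this separates `w`, by the shortcut lemma and the triangle `x₁x₂x₃` of label `1` at `w`; if `x₃`
is on the path, the two shortcuts of `TriClaim10Prep.faceVertex_not_mem_support`). Adapted from
`TriClaim10Prep.lean` (site version), whose list bookkeeping is reused verbatim.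

## References

* B. Bollobás, O. Riordan, *Percolation*, CUP (2006), Ch. 7, Claim 10 p. 177.
-/

namespace Summit.CriticalPhenomena.CardyFormulaZ2.Theorems.BondTriangularCardyLine.KiteB

open Finset Literature.Probability.Percolation Literature.Probability.LatticeModels
open TriMarkedDomain (fin3_add_one_add_one fin3_add_two_add_one fin3_add_two_add_two fin3_add_one_add_two)

section Frame

variable (D : TriMarkedDomain 3) {σ : CLHexConfig} {w : HexVertex} {r : Fin 3} {Q : List (Site 2)} {nu nv : ℕ}

/-- **The shortcut lemma, Chayes–Lei form** (`TriClaim10Prep.faceLabel_loop_eq_zero_of_shortcut`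
with the single use of "no admissible path separates `w`" turned into the hypothesis that the
shortcut path `Q° = L₁ ++ (p :: R ++ [q]) ++ L₂` does not separate `w` from `A₀`): the segment
`S` of `Q` closed up backwards along the new piece is a loop with `w` outside. -/
theorem faceLabel_loop_eq_zero_of_shortcutCL (hQne : Q ≠ []) (hQG : ∀ s ∈ Q, s ∈ D.verts)
    (hnu1 : D.pos 1 ≤ nu) (hnu2 : nu < D.pos 2) (hnv2 : D.pos 2 ≤ nv) (hnvL : nv < #(triBdryDarts D.verts))
    (hC : IsTriLoop (D.chordLoop Q nv (nu + #(triBdryDarts D.verts) - nv)))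
    (hπw : faceLabel (cycDarts (D.chordLoop Q nv (nu + #(triBdryDarts D.verts) - nv))) w =
      leftLabel (D.chordLoop Q nv (nu + #(triBdryDarts D.verts) - nv)))
    {L₁ S R L₂ : List (Site 2)} (hS : S ≠ []) (hQeq : Q = L₁ ++ S ++ L₂)
    (hns : ¬ Separates D.verts {e : Sym2 (Site 2) | ∃ d ∈ pathDarts (L₁ ++ (S.head hS :: R ++ [S.getLast hS]) ++ L₂),
      e = s(d.1, d.2)} w (D.stretch 0))
    (hΘ : IsTriLoop (S ++ R.reverse)) (hΘG : ∀ s ∈ S ++ R.reverse, s ∈ D.verts) :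
    faceLabel (cycDarts (S ++ R.reverse)) w = 0 := by
  -- adapted from `TriClaim10Prep.faceLabel_loop_eq_zero_of_shortcut` (site version)
  set L := #(triBdryDarts D.verts) with hL
  set C := D.chordLoop Q nv (nu + L - nv) with hCdef
  set p := S.head hS with hp
  set q := S.getLast hS with hq
  set Q' := L₁ ++ (p :: R ++ [q]) ++ L₂ with hQ'
  have hlen : nv + (nu + L - nv) = nu + L := by omega
  unfold Separates at hns
  push Not at hns
  obtain ⟨F, hF, hreach⟩ := hns
  have hΘdarts : ∀ d ∈ cycDarts (S ++ R.reverse), d.1 ∈ D.verts ∧ d.2 ∈ D.verts := fun d hd =>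
    ⟨hΘG _ (mem_of_mem_cycDarts hd).1, hΘG _ (mem_of_mem_cycDarts hd).2⟩
  have hpar : ∀ x y, x ∈ D.verts → y ∈ D.verts →
      s(x, y) ∉ {e : Sym2 (Site 2) | ∃ d ∈ pathDarts Q', e = s(d.1, d.2)} →
      lbond (cycDarts C) x y = lbond (cycDarts (S ++ R.reverse)) x y := by
    intro x y hx hy hnot
    rw [hC.lbond_eq_ite, hΘ.lbond_eq_ite]
    have hnot' : ¬ ∃ d ∈ pathDarts Q', s(x, y) = s(d.1, d.2) := hnot
    have hRne : p :: R ++ [q] ≠ [] := by simp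
    rw [hQ', TriMarkedDomain.exists_mem_pathDarts_three_iff hRne] at hnot'
    simp only [not_or] at hnot'
    obtain ⟨hn1, hn2, hn3⟩ := hnot'
    have hheadR : (p :: R ++ [q]).head hRne = p := by simp
    have hlastR : (p :: R ++ [q]).getLast hRne = q := by simp
    rw [hheadR] at hn1
    rw [hlastR] at hn3
    have hCiff : (∃ d ∈ cycDarts C, s(x, y) = s(d.1, d.2)) ↔ ∃ d ∈ pathDarts S, s(x, y) = s(d.1, d.2) := by
      constructor
      · rintro ⟨d, hd, he⟩
        have h12 : d.1 ∈ D.verts ∧ d.2 ∈ D.verts := by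
          have h1 : d.1 ∈ s(x, y) := by rw [he]; exact Sym2.mem_mk_left _ _
          have h2 : d.2 ∈ s(x, y) := by rw [he]; exact Sym2.mem_mk_right _ _
          constructor
          · rcases Sym2.mem_iff.1 h1 with h | h <;> (rw [h]; assumption)
          · rcases Sym2.mem_iff.1 h2 with h | h <;> (rw [h]; assumption)
        have hdQ := D.mem_pathDarts_of_mem_cycDarts_chordLoop hQne hd h12.1 h12.2
        have : ∃ d ∈ pathDarts Q, s(x, y) = s(d.1, d.2) := ⟨d, hdQ, he⟩
        rw [hQeq, TriMarkedDomain.exists_mem_pathDarts_three_iff hS] at this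
        rcases this with h | h | h
        · exact absurd h hn1
        · exact h
        · exact absurd h hn3
      · rintro ⟨d, hd, he⟩
        have : ∃ d' ∈ pathDarts (L₁ ++ S ++ L₂), s(d.1, d.2) = s(d'.1, d'.2) := by
          rw [TriMarkedDomain.exists_mem_pathDarts_three_iff hS]; exact Or.inr (Or.inl ⟨d, hd, rfl⟩)
        obtain ⟨d', hd', he'⟩ := this
        rw [← hQeq] at hd'
        exact ⟨d', D.mem_cycDarts_chordLoop_of_mem_pathDarts (nv := nv) hQne (nu + L - nv) hd', he.trans he'⟩
    have hΘiff : (∃ d ∈ cycDarts (S ++ R.reverse), s(x, y) = s(d.1, d.2)) ↔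
        ∃ d ∈ pathDarts S, s(x, y) = s(d.1, d.2) := by
      have hSeq : S = p :: S.tail := (List.cons_head_tail hS).symm
      have hcyc : cycDarts (S ++ R.reverse) = pathDarts ([] ++ S ++ (p :: R).reverse) := by
        rw [List.nil_append, List.reverse_cons, ← List.append_assoc]
        conv_lhs => rw [hSeq, List.cons_append]
        show pathDarts (p :: (S.tail ++ R.reverse) ++ [p]) = _
        rw [← List.cons_append, ← hSeq]
      rw [hcyc, TriMarkedDomain.exists_mem_pathDarts_three_iff hS]
      simp only [List.nil_append, pathDarts_singleton, List.not_mem_nil, false_and, exists_false, false_or]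
      have hrev : q :: (p :: R).reverse = (p :: R ++ [q]).reverse := by simp
      rw [show S.getLast hS = q from rfl, hrev, exists_mem_pathDarts_reverse_iff]
      constructor
      · rintro (h | h)
        · exact h
        · exact absurd h hn2
      · exact fun h => Or.inl h
    simp only [hCiff, hΘiff]
  have hsum := faceLabel_add_eq_of_reflTransGen_dualStep hC.adj hΘ.adj hpar hreach
  have hπF : faceLabel (cycDarts C) F = leftLabel C :=
    D.faceLabel_eq_leftLabel_of_stretch_zero hQne hQG hnu1 hnu2 hnv2 hnvL hlen hC hF
  have hθF : faceLabel (cycDarts (S ++ R.reverse)) F = 0 := by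
    obtain ⟨d, hd, -, hd2⟩ := hF
    obtain ⟨p', -, rfl⟩ := D.mem_stretch_zero_iff3.1 hd
    exact D.faceLabel_eq_zero_of_bdryHead_mem hΘ.adj hΘdarts (n := p') hd2
  rw [hπw, hπF, hθF] at hsum
  have key : ∀ a b : ZMod 2, a + b = a + 0 → b = 0 := by decide
  exact key _ _ hsum

/-- Yellow adjacency of the darts of a modified path, from its bonds: if every bond of `Q'` is a
bond of `Q` or one of the listed yellow bonds, the darts of `Q'` are yellow-adjacent. -/
theorem yellowDarts_of_bonds {Q' : List (Site 2)} {Y : Set (Sym2 (Site 2))}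
    (hQY : ∀ d ∈ pathDarts Q, (clYellowGraph σ).Adj d.1 d.2)
    (hY : ∀ x y, s(x, y) ∈ Y → (clYellowGraph σ).Adj x y)
    (hsub : ∀ d ∈ pathDarts Q', (∃ d' ∈ pathDarts Q, s(d.1, d.2) = s(d'.1, d'.2)) ∨ s(d.1, d.2) ∈ Y) :
    ∀ d ∈ pathDarts Q', (clYellowGraph σ).Adj d.1 d.2 := by
  intro d hd
  rcases hsub d hd with ⟨d', hd', he⟩ | h
  · have h' := hQY d' hd'
    rcases Sym2.eq_iff.1 he with ⟨h1, h2⟩ | ⟨h1, h2⟩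
    · rw [h1, h2]; exact h'
    · rw [h1, h2]; exact h'.symm
  · exact hY _ _ h

/-- **Bonds up to the head of a segment of a path, and from its last site, are bonds of the whole
path** (registered anchor of this file). -/
theorem bonds_three_sub : ∀ {L₁ S L₂ : List (Literature.Probability.LatticeModels.Site 2)} (hS : S ≠ []) {e : Sym2 (Literature.Probability.LatticeModels.Site 2)}, ((∃ d ∈ Literature.Probability.Percolation.pathDarts (L₁ ++ [S.head hS]), e = s(d.1, d.2)) ∨ (∃ d ∈ Literature.Probability.Percolation.pathDarts (S.getLast hS :: L₂), e = s(d.1, d.2))) → ∃ d ∈ Literature.Probability.Percolation.pathDarts (L₁ ++ S ++ L₂), e = s(d.1, d.2) := by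
  intro L₁ S L₂ hS e h
  rw [TriMarkedDomain.exists_mem_pathDarts_three_iff hS]
  rcases h with h | h
  · exact Or.inl h
  · exact Or.inr (Or.inr h)

/-- **No hexagon-triangle at `w`: the three hexagons of `w` are not all yellow at the corner `w`.**
In the frame of `A₀` — `Q` the separating yellow path through the bond `x₁x₂` with `w` on its left,
no yellow path with the same ends separating `w` — if `x₃` were yellow-adjacent to both `x₁` and
`x₂` (and not pure blue), then: `x₃` off the path gives the reroute `… x₁ x₃ x₂ …`, and the
triangle `x₁x₂x₃`, of label `1` at `w`, would have label `0` by the shortcut lemma; `x₃` on the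
path, before `x₁` or after `x₂`, gives two shortcuts whose loops add up, at `w`, to the triangle
(`TriClaim10Prep.faceVertex_not_mem_support`, verbatim). -/
theorem false_of_yellow_at_w (hQne : Q ≠ []) (hQnd : Q.Nodup) (hQch : List.IsChain triGraph.Adj Q)
    (hQG : ∀ s ∈ Q, s ∈ D.verts) (hQB : ∀ s ∈ Q, σ s ≠ CLHexState.B)
    (hQY : ∀ d ∈ pathDarts Q, (clYellowGraph σ).Adj d.1 d.2)
    (hnu1 : D.pos 1 ≤ nu) (hnu2 : nu < D.pos 2) (hnv2 : D.pos 2 ≤ nv) (hnvL : nv < #(triBdryDarts D.verts))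
    (hC : IsTriLoop (D.chordLoop Q nv (nu + #(triBdryDarts D.verts) - nv)))
    (hπw : faceLabel (cycDarts (D.chordLoop Q nv (nu + #(triBdryDarts D.verts) - nv))) w =
      leftLabel (D.chordLoop Q nv (nu + #(triBdryDarts D.verts) - nv)))
    (hnotw : ∀ Q' : List (Site 2), (hne : Q' ≠ []) → Q'.Nodup → List.IsChain triGraph.Adj Q' →
      (∀ s ∈ Q', s ∈ D.verts ∧ σ s ≠ CLHexState.B) → (∀ d ∈ pathDarts Q', (clYellowGraph σ).Adj d.1 d.2) →
      Q'.head hne = Q.head hQne → Q'.getLast hne = Q.getLast hQne →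
      ¬ Separates D.verts {e : Sym2 (Site 2) | ∃ d ∈ pathDarts Q', e = s(d.1, d.2)} w (D.stretch 0))
    (hw : hexFaceVertices w ⊆ D.verts)
    (hdart : (faceVertex w (r + 1), faceVertex w (r + 2)) ∈ pathDarts Q)
    (hxB : σ (faceVertex w r) ≠ CLHexState.B)
    (hxa : (clYellowGraph σ).Adj (faceVertex w r) (faceVertex w (r + 1)))
    (hxb : (clYellowGraph σ).Adj (faceVertex w r) (faceVertex w (r + 2))) : False := by
  -- adapted from `TriClaim10Prep.faceVertex_not_mem_of_not_mem` / `faceVertex_not_mem_support`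
  set x := faceVertex w r with hx
  set a := faceVertex w (r + 1) with ha
  set b := faceVertex w (r + 2) with hb
  have hinj := faceVertex_injective w
  have hxa' : x ≠ a := fun e => absurd (add_eq_left.1 (hinj e).symm) (by decide)
  have hxb' : x ≠ b := fun e => absurd (add_eq_left.1 (hinj e).symm) (by decide)
  have hab : a ≠ b := fun e => absurd (add_left_cancel (hinj e)) (by decide)
  have e2 : r + 1 + 1 = r + 2 := fin3_add_one_add_one r
  have e4 : r + 1 + 2 = r := fin3_add_one_add_two r
  have hwG : ∀ s, s = x ∨ s = a ∨ s = b → s ∈ D.verts := by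
    rintro s (rfl | rfl | rfl) <;> exact hw (faceVertex_mem _ _)
  -- the yellow bonds available for the new paths
  set Y : Set (Sym2 (Site 2)) := {s(x, a), s(x, b)} with hYdef
  have hY : ∀ p q, s(p, q) ∈ Y → (clYellowGraph σ).Adj p q := by
    intro p q h
    simp only [hYdef, Set.mem_insert_iff, Set.mem_singleton_iff] at h
    rcases h with h | h
    · rcases Sym2.eq_iff.1 h with ⟨rfl, rfl⟩ | ⟨rfl, rfl⟩
      · exact hxa
      · exact hxa.symm
    · rcases Sym2.eq_iff.1 h with ⟨rfl, rfl⟩ | ⟨rfl, rfl⟩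
      · exact hxb
      · exact hxb.symm
  have h1ne : (1 : ZMod 2) ≠ 0 := by decide
  -- the shortcut of a segment `S` of `Q` from `p` to `q` through a (possibly empty) new piece `R'`
  -- of sites among `x`, with all new bonds in `Y`: a loop with `w` outside
  have shortcut : ∀ {L₁ S R' L₂ : List (Site 2)} (hS : S ≠ []), Q = L₁ ++ S ++ L₂ → 2 ≤ S.length →
      (∀ s ∈ R', s = x ∧ s ∉ Q) → R'.Nodup →
      List.IsChain triGraph.Adj (S.head hS :: R' ++ [S.getLast hS]) →
      (∀ d ∈ pathDarts (S.head hS :: R' ++ [S.getLast hS]), s(d.1, d.2) ∈ Y) →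
      IsTriLoop (S ++ R'.reverse) → faceLabel (cycDarts (S ++ R'.reverse)) w = 0 := by
    intro L₁ S R' L₂ hS hQeq hS2 hR' hR'nd hch' hnew hΘ
    have hSnd : S.Nodup := by
      have := hQeq ▸ hQnd
      exact ((List.nodup_append.1 this).1 |> fun h => (List.nodup_append.1 h).2.1)
    have hSG : ∀ s ∈ S, s ∈ D.verts := fun s hs => hQG s (by rw [hQeq]; simp [hs])
    have hS' : S.head hS :: R' ++ [S.getLast hS] ≠ [] := by simp
    refine faceLabel_loop_eq_zero_of_shortcutCL D hQne hQG hnu1 hnu2 hnv2 hnvL hC hπw hS hQeq ?_ hΘ ?_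
    · refine hnotw _ (by simp) ?_ ?_ ?_ ?_ ?_ ?_
      · -- duplicate-free
        have hne : S.head hS ≠ S.getLast hS := by
          rw [List.head_eq_getElem_zero hS, List.getLast_eq_getElem]
          intro e
          have := (hSnd.getElem_inj_iff).1 e
          omega
        refine nodup_append3_of_nodup (hQeq ▸ hQnd) ?_ fun s hs => ?_
        · rw [show S.head hS :: R' ++ [S.getLast hS] = S.head hS :: (R' ++ [S.getLast hS]) from rfl, List.nodup_cons,
            List.nodup_append]
          refine ⟨?_, hR'nd, List.nodup_singleton _, ?_⟩
          · simp only [List.mem_append, List.mem_singleton, not_or]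
            exact ⟨fun h => (hR' _ h).2 (by rw [hQeq]; simp [List.head_mem hS]), hne⟩
          · intro s hs t ht hst
            rw [List.mem_singleton] at ht
            subst ht; subst hst
            exact (hR' _ hs).2 (by rw [hQeq]; simp [List.getLast_mem hS])
        · have hs' : s = S.head hS ∨ s ∈ R' ∨ s = S.getLast hS := by simpa [or_assoc] using hs
          rcases hs' with rfl | h | rfl
          · exact Or.inl (List.head_mem hS)
          · exact Or.inr (by rw [← hQeq]; exact (hR' _ h).2)
          · exact Or.inl (List.getLast_mem hS)
      · exact isChain_append3_of_isChain hS hS' (hQeq ▸ hQch) hch' (by simp) (by simp)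
      · intro s hs
        have hs' : s ∈ L₁ ∨ (s = S.head hS ∨ s ∈ R' ∨ s = S.getLast hS) ∨ s ∈ L₂ := by simpa [or_assoc] using hs
        have : s ∈ Q ∨ s = x := by
          rw [hQeq]
          rcases hs' with h | (rfl | h | rfl) | h
          · exact Or.inl (by simp [h])
          · exact Or.inl (by simp [List.head_mem hS])
          · exact Or.inr (hR' _ h).1
          · exact Or.inl (by simp [List.getLast_mem hS])
          · exact Or.inl (by simp [h])
        rcases this with h | rfl
        · exact ⟨hQG s h, hQB s h⟩
        · exact ⟨hwG _ (Or.inl rfl), hxB⟩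
      · refine yellowDarts_of_bonds hQY hY fun d hd => ?_
        have h3 := (TriMarkedDomain.exists_mem_pathDarts_three_iff hS' (e := s(d.1, d.2))).1 ⟨d, hd, rfl⟩
        rcases h3 with h | h | h
        · left; rw [hQeq]; exact bonds_three_sub hS (Or.inl (by simpa using h))
        · right; obtain ⟨d', hd', he⟩ := h; rw [he]; exact hnew d' hd'
        · left; rw [hQeq]; exact bonds_three_sub hS (Or.inr (by simpa using h))
      · rw [head_append3_eq hS hS' (by simp)]; congr 1; exact hQeq.symm
      · rw [getLast_append3_eq hS hS' (by simp)]; congr 1; exact hQeq.symm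
    · intro s hs
      rw [List.mem_append, List.mem_reverse] at hs
      rcases hs with h | h
      · exact hSG s h
      · exact hwG _ (Or.inl (hR' _ h).1)
  obtain ⟨L₁, L₂, hQeq⟩ := exists_append_of_mem_pathDarts hdart
  have hadj_xa : triGraph.Adj x a := TriMarkedDomain.adj_faceVertex_succ w r
  have hadj_ab : triGraph.Adj a b := by rw [hb, ← e2]; exact TriMarkedDomain.adj_faceVertex_succ w (r + 1)
  have hadj_bx : triGraph.Adj b x := by
    have := TriMarkedDomain.adj_faceVertex_succ w (r + 2); rwa [fin3_add_two_add_one] at this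
  by_cases hxQ : x ∈ Q
  · -- `x₃` on the path: two shortcuts (verbatim `faceVertex_not_mem_support`)
    have zkey : ∀ A B C : ZMod 2, A + B = 0 → A + C = 0 → B + C = 0 := by decide
    have shortcut0 : ∀ {L₁ S L₂ : List (Site 2)} (hS : S ≠ []), Q = L₁ ++ S ++ L₂ →
        triGraph.Adj (S.getLast hS) (S.head hS) → s(S.head hS, S.getLast hS) ∈ Y → 3 ≤ S.length →
        faceLabel (cycDarts S) w = 0 := by
      intro L₁ S L₂ hS hQeq hpq hpqY h3
      have hSnd : S.Nodup := by
        have := hQeq ▸ hQnd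
        exact ((List.nodup_append.1 this).1 |> fun h => (List.nodup_append.1 h).2.1)
      have hSch : List.IsChain triGraph.Adj S := isChain_of_append3 (hQeq ▸ hQch)
      have key := shortcut (R' := []) hS hQeq (by omega) (by simp) List.nodup_nil (by simpa using hpq.symm)
        (by simpa using hpqY) (by rw [List.reverse_nil, List.append_nil]; exact ⟨hSnd, h3, adj_cycDarts_of_isChain hS hSch hpq⟩)
      rwa [List.reverse_nil, List.append_nil] at key
    have hx12 : x ∈ L₁ ∨ x ∈ L₂ := by
      have : x ∈ L₁ ++ a :: b :: L₂ := hQeq ▸ hxQ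
      simp only [List.mem_append, List.mem_cons] at this
      rcases this with h | h | h | h
      · exact Or.inl h
      · exact absurd h hxa'
      · exact absurd h hxb'
      · exact Or.inr h
    have hYxa : s(x, a) ∈ Y := by simp [hYdef]
    have hYxb : s(x, b) ∈ Y := by simp [hYdef]
    have hYax : s(a, x) ∈ Y := by rw [Sym2.eq_swap]; exact hYxa
    have hYbx : s(b, x) ∈ Y := by rw [Sym2.eq_swap]; exact hYxb
    rcases hx12 with hx1 | hx2
    · obtain ⟨L₀, M, hL₁⟩ := List.append_of_mem hx1
      have hQ1 : Q = L₀ ++ (x :: (M ++ [a, b])) ++ L₂ := by rw [hQeq, hL₁]; simp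
      have θ₁ := shortcut0 (S := x :: (M ++ [a, b])) (List.cons_ne_nil _ _) hQ1 (by simpa using hadj_bx)
        (by simpa using hYxb) (by simp)
      by_cases hM : M = []
      · subst hM
        have h1 := faceLabel_triangle_self' w r
        change faceLabel (cycDarts [x, a, b]) w = 1 at h1
        simp only [List.nil_append] at θ₁
        rw [θ₁] at h1
        exact h1ne h1.symm
      · have hQ2 : Q = L₀ ++ (x :: (M ++ [a])) ++ (b :: L₂) := by rw [hQeq, hL₁]; simp
        have θ₂ := shortcut0 (S := x :: (M ++ [a])) (List.cons_ne_nil _ _) hQ2 (by simpa using hadj_xa.symm)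
          (by simpa using hYxa) (by simp; have := List.length_pos_iff.2 hM; omega)
        have hne0 : x :: (M ++ [a]) ≠ [] := List.cons_ne_nil _ _
        have hlast0 : (x :: (M ++ [a])).getLast hne0 = a := by simp
        have hc1 : cycDarts (x :: (M ++ [a, b])) = pathDarts (x :: (M ++ [a])) ++ [(a, b), (b, x)] := by
          show pathDarts (x :: (M ++ [a, b]) ++ [x]) = _
          rw [show x :: (M ++ [a, b]) ++ [x] = (x :: (M ++ [a])) ++ [b, x] by simp,
            pathDarts_append hne0 (by simp), hlast0]
          rfl
        have hc2 : cycDarts (x :: (M ++ [a])) = pathDarts (x :: (M ++ [a])) ++ [(a, x)] := by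
          show pathDarts (x :: (M ++ [a]) ++ [x]) = _
          rw [pathDarts_append_singleton hne0, hlast0]
        rw [hc1, faceLabel_append] at θ₁
        rw [hc2, faceLabel_append] at θ₂
        have h3 := zkey _ _ _ θ₁ θ₂
        rw [← faceLabel_append] at h3
        have h1 := TriMarkedDomain.faceLabel_three_darts_eq_one w (r + 1) (d₁ := (a, b)) (d₂ := (b, x)) (d₃ := (a, x))
          (by rw [e2]) (by rw [e2, e4]) (by rw [e4, Sym2.eq_swap])
        exact h1ne (h1.symm.trans h3)
    · obtain ⟨M, L₃, hL₂⟩ := List.append_of_mem hx2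
      have hQ1 : Q = L₁ ++ (a :: b :: (M ++ [x])) ++ L₃ := by rw [hQeq, hL₂]; simp
      have θ₁ := shortcut0 (S := a :: b :: (M ++ [x])) (List.cons_ne_nil _ _) hQ1 (by simpa using hadj_xa)
        (by simpa using hYax) (by simp)
      by_cases hM : M = []
      · subst hM
        have h1 := faceLabel_triangle_self' w (r + 1)
        rw [e2, e4] at h1
        change faceLabel (cycDarts [a, b, x]) w = 1 at h1
        simp only [List.nil_append] at θ₁
        rw [θ₁] at h1
        exact h1ne h1.symm
      · have hQ2 : Q = (L₁ ++ [a]) ++ (b :: (M ++ [x])) ++ L₃ := by rw [hQeq, hL₂]; simp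
        have θ₂ := shortcut0 (S := b :: (M ++ [x])) (List.cons_ne_nil _ _) hQ2 (by simpa using hadj_bx.symm)
          (by simpa using hYbx) (by simp; have := List.length_pos_iff.2 hM; omega)
        have hne0 : b :: (M ++ [x]) ≠ [] := List.cons_ne_nil _ _
        have hlast0 : (b :: (M ++ [x])).getLast hne0 = x := by simp
        have hc1 : cycDarts (a :: b :: (M ++ [x])) = [(a, b)] ++ (pathDarts (b :: (M ++ [x])) ++ [(x, a)]) := by
          show pathDarts (a :: b :: (M ++ [x]) ++ [a]) = _
          rw [show a :: b :: (M ++ [x]) ++ [a] = a :: (b :: (M ++ [x]) ++ [a]) by simp,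
            show b :: (M ++ [x]) ++ [a] = b :: (M ++ [x] ++ [a]) by simp, pathDarts_cons_cons,
            show b :: (M ++ [x] ++ [a]) = b :: (M ++ [x]) ++ [a] by simp, pathDarts_append_singleton hne0, hlast0]
          rfl
        have hc2 : cycDarts (b :: (M ++ [x])) = pathDarts (b :: (M ++ [x])) ++ [(x, b)] := by
          show pathDarts (b :: (M ++ [x]) ++ [b]) = _
          rw [pathDarts_append_singleton hne0, hlast0]
        rw [hc1, faceLabel_append, faceLabel_append] at θ₁
        rw [hc2, faceLabel_append] at θ₂
        have zkey' : ∀ A P B C : ZMod 2, A + (P + B) = 0 → P + C = 0 → A + (B + C) = 0 := by decide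
        have h3 := zkey' _ _ _ _ θ₁ θ₂
        rw [← faceLabel_append, ← faceLabel_append] at h3
        have h1 := TriMarkedDomain.faceLabel_three_darts_eq_one w (r + 1) (d₁ := (a, b)) (d₂ := (x, b)) (d₃ := (x, a))
          (by rw [e2]) (by rw [e2, e4, Sym2.eq_swap]) (by rw [e4])
        have hp : ([(a, b)] ++ ([(x, a)] ++ [(x, b)])).Perm [(a, b), (x, b), (x, a)] :=
          List.Perm.cons _ (List.Perm.swap _ _ _)
        rw [faceLabel_perm hp] at h3
        exact h1ne (h1.symm.trans h3)
  · -- `x₃` off the path: reroute through it (verbatim `faceVertex_not_mem_of_not_mem`)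
    have hQeq' : Q = L₁ ++ [a, b] ++ L₂ := by rw [hQeq, List.append_assoc]; rfl
    have hS : ([a, b] : List (Site 2)) ≠ [] := List.cons_ne_nil _ _
    have key := shortcut (L₁ := L₁) (S := [a, b]) (R' := [x]) (L₂ := L₂) hS hQeq' (by simp) (by simpa using hxQ)
      (List.nodup_singleton _) (by simpa using ⟨hadj_xa.symm, hadj_bx.symm⟩) ?_ ?_
    · have h1 := faceLabel_triangle_self' w (r + 1)
      rw [e2, e4] at h1
      change faceLabel (cycDarts [a, b, x]) w = 0 at key
      rw [key] at h1
      exact absurd h1 (by decide)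
    · intro d hd
      simp only [List.head_cons, List.getLast_cons_cons, List.getLast_singleton, List.cons_append, List.nil_append,
        pathDarts_cons_cons, pathDarts_singleton, List.mem_cons, List.not_mem_nil, or_false] at hd
      rcases hd with rfl | rfl
      · simp [hYdef, Sym2.eq_swap]
      · simp [hYdef]
    · have := isTriLoop_faceVertex' w (r + 1)
      rwa [e2, e4] at this

end Frame

end Summit.CriticalPhenomena.CardyFormulaZ2.Theorems.BondTriangularCardyLine.KiteB
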